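import Summits.BirchSwinnertonDyer.Rank1Residual.Additive.KatoDescentRankOneCountRows
import Summits.BirchSwinnertonDyer.Rank1Residual.Additive.KatoDescentRealizableContraOfFactsImai
import Summits.BirchSwinnertonDyer.Rank1Residual.Additive.KatoDescentIntegralH1RankOne
import Literature.NumberTheory.EllipticCurves.Kato2004.IwasawaH2FineSelmerDualLoc
import Literature.NumberTheory.EllipticCurves.Kato2004.IwasawaH1RankLeOneProofs
import HarnessLib

set_option autoImplicit false

/-!
# Stub 4 (realisability of the Kato descent datum at the print-exact closed binders) ON THE RANK-ONE ROWS from H2X′ ALONE —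
# WITHOUT `Kato2004.thm12_4` (seat `bsd-cm-prr-ty1` g17, cell `bsd-cm`; theorems only: no definition, no named fact, no instance,
# no `sorry`)

Part 54 of the seat's kernel cut of the Kato–Perrin-Riou skeletons (cruxes stmt-BirchSwinnertonDyer-19945 / -19223; registered
lines `kato_perrin_riou_zp` v5 / `kato_perrin_riou_istar` v5).  v5 closes v4's stub 4 VERBATIM in-file,
`realizable_closed : TorsionFree.RealizableOfKMC IsKatoZetaDescentDatumOfContra KatoMainConjectureFineContra :=
StrictCount.realizableOfKMC_contra_of_thm12_4_of_loc stub_printFactsKato.1 stub_printFactsKato.2.1` (E49 ← E21 ← g6's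
`ContraRealizable.exists_isKatoZetaDescentDatumOfContra_of_kmcFineContra`), whose ONE use of the named fact `Kato2004.thm12_4` is
GENUINE: the datum's field `isTorsion_quotient : IsTorsion (𝐇¹ ⧸ Λ∙z₀)` needs `rank_Λ 𝐇¹_Γ(T_pW) ≤ 1`
(`exists_isKatoZetaDescentDatumOfContra_of_packages … hfin htf hrk …`).  `TorsionFree.RealizableOfKMC` quantifies over EVERY
torsion-free member (`p ≠ 2`, `Addv`, `0 ≤ v_p j`, `p ∤ #W(ℚ)_tors`), and OFF the rank-one rows `rank_Λ 𝐇¹ ≤ 1` is Kato Thm. 12.4 (2)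
proper (12.4 (1)-strength), not a tree theorem — so stub 4 VERBATIM keeps `thm12_4` (reported to the planner, STATUS
2026-08-29T14:18Z).  But the compositions (E50) apply realisability ONLY at the row pair, where GZK gives Mordell–Weil rank `1` and
finite `Ш`, and THERE every consumed clause of 12.4 (2) is a tree theorem:
* finite generation (12.2.1) — `IwasawaH1Data.module_finite_of_isCyclotomic`; torsion-freeness — `IwasawaH1Data.isTorsionFree`;
* `𝐇¹ ≠ 0` — the admissible class `z₀` of `KatoMainConjectureFineContra W p` is non-zero: `IsAdmissibleZetaClass.ne_zero_of_rohrlich` +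
  `PSRohrlichAtLevel.rohrlich_primePow_of_isNewformOf` (ALREADY used at this very spot by g6's theorem);
* `rank_Λ 𝐇¹ = 1` — cn100's `IwasawaH1Data.rank_eq_one_of_rank_integralH1_le_one` on (R1) `LocPKummer.rank_integralH1_le_one κ hrk hsha`.
THIS FILE:
* §1 `exists_isKatoZetaDescentDatumOfContra_of_loc_of_rankOne (hloc) W p (hp) (hj) (hrk) (hsha) (hKMC)` — per pair: a realised
  contragredient datum from H2X′ (`Kato2004.exists_iwasawaH2Data_fineSelmerDual_embedding_loc`, via `.embedding` = H2X and Imai's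
  theorem `finite_fixedPoints_kerSubgroup_inf_decomp`) and `KatoMainConjectureFineContra W p`, for `W` of rank `1` with `Ш(W)[p^∞]`
  finite — g6's proof with the `h12` line replaced by the four tree theorems; `…_of_gzk` variant (`W.analyticRank = 1`, GZK);
* §2 ★ `realizableIstarZeroOfGZK_of_loc (hloc)` — stub 4 ON THE ROWS OF 19223, GZK-guarded exactly like v5's `rowCount_closed`:
  `GZK → ∀ p [Fact p.Prime], 5 ≤ p → ∀ W [..][..], HasSignedLocalType W p (.Istar 0) → W.analyticRank = 1 →
  KatoMainConjectureFineContra W p → ∃ D, IsKatoZetaDescentDatumOfContra W p D` (binder text = E50's `hCrows` row guards + stub 4's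
  per-pair conclusion; no new display);
* §3 ★ `realizableClassCSevenOfGZK_of_loc (hloc)` — stub 4 ON THE ROWS OF 19945: `GZK → ∀ W [..][..][Fact (Nat.Prime 7)],
  X12.ClassCSeven W → KatoMainConjectureFineContra W 7 → ∃ D, IsKatoZetaDescentDatumOfContra W 7 D`.
Part 55 (`KatoDescentKMCImpReadingRowRealizable.lean`) re-keys E50's compositions to these ROW-KEYED realisability shapes.
HONEST LABEL: theorems only, CONDITIONAL on {H2X′, GZK, KMC on the rows}; the registered v5 stubs are NOT touched or closed (the
planner registers skeletons); nothing asserted on 19945 / 19223; Kato's Conj. 12.10, Perrin-Riou's conjecture and Kato's Thm. 12.4 (the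
tree's named fact) untouched; no summit statement is proved by this seat; BSD is not proved for any curve.
References: [Kato2004Asterisque] (12.2.1) (p. 220), Thm. 12.4 (2) (p. 221), Thm. 12.5 (1) and proof (pp. 221–222), Conj. 12.10 (p. 224),
(14.9.1) (p. 239), §14.14 (14.14.1) (p. 243) [corpus: paper:doi-10-24033-ast-639 p105–p109, p124, p128]; [Imai1975] Theorem (p. 12);
[RohrlichInventiones1984] Theorem (p. 409); [GrossZagier1986] Thm. I.7.3; [Mazur1977] Ch. III §5 Step 1 (p. 158).
-/

noncomputable section

open scoped Classical NumberField

open WeierstrassCurve Field IsDedekindDomain NumberField Literature.NumberTheory.EllipticCurves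
  Literature.NumberTheory.EllipticCurves.Kato2004 Literature.NumberTheory.GaloisRepresentations
  Literature.NumberTheory.EllipticCurves.IwasawaAlgebra Literature.NumberTheory.EllipticCurves.Rank1Residual
  Literature.NumberTheory.EllipticCurves.Rank1Residual.Typed
open Summit.BirchSwinnertonDyer.Rank1Residual Summit.BirchSwinnertonDyer.Rank1Residual.Additive
  Summit.BirchSwinnertonDyer.Rank1Residual.X12.O10
  Summit.BirchSwinnertonDyer.BirchSwinnertonDyer.Theorems.TowerTorsionFiniteOrdinary
open Summit.BirchSwinnertonDyer.BirchSwinnertonDyer.Theorems.PSRohrlichAtLevel (rohrlich_primePow_of_isNewformOf)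
open Summit.BirchSwinnertonDyer.BirchSwinnertonDyer.Theorems.RamifiedSevenEllipticUnits (seven_nsmul_eq_zero_padic)
open Summit.BirchSwinnertonDyer.BirchSwinnertonDyer.Theorems.InertBadLeafKMCPerrinRiou (padicValRat_j_nonneg_of_hasCM)

namespace Summit.BirchSwinnertonDyer.Rank1Residual.Additive.StrictCount

/-! ## §1 Per pair on a rank-one row: the realised datum from H2X′ and KMC, no `thm12_4` -/

section PerPair

/-- **Per pair `(W, p)`, `p ≠ 2`, `0 ≤ v_p(j(W))`, `W` of Mordell–Weil rank `1` with `Ш(W)[p^∞]` finite: a realised contragredient Kato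
descent datum from H2X′ and `KatoMainConjectureFineContra W p` — WITHOUT `Kato2004.thm12_4`.**  g6's
`ContraRealizable.exists_isKatoZetaDescentDatumOfContra_of_kmcFineContra` with its line `obtain ⟨hfin, ⟨htf, hrk⟩, -⟩ := h12 W p κ γ hκ hγ I`
replaced by tree theorems at the pin of the admissible class `z₀` of `KMC`: (12.2.1) `module_finite_of_isCyclotomic`, torsion-freeness
`isTorsionFree`, `z₀ ≠ 0` by `IsAdmissibleZetaClass.ne_zero_of_rohrlich` + Rohrlich at any `p` (as g6 already had), and `rank = 1` by
`rank_eq_one_of_rank_integralH1_le_one` on (R1) `LocPKummer.rank_integralH1_le_one κ hrk hsha`; the (H2ᶜ)-pinned package from H2X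
(`hloc.embedding`) with Imai's finiteness `finite_fixedPoints_kerSubgroup_inf_decomp` (tree theorem).  CONDITIONAL on H2X′ and `KMC`;
nothing asserted about 12.10 or BSD.
[cite: Kato2004Asterisque, §12.2 (12.2.1) (p. 220), Thm. 12.4 (2) (p. 221), Thm. 12.5 (1) and proof (pp. 221–222), Conj. 12.10 (p. 224), (14.9.1) (p. 239), §14.14 (14.14.1) (p. 243)]
[cite: Imai1975, Theorem (p. 12)] [cite: RohrlichInventiones1984, Theorem (p. 409)] -/
theorem exists_isKatoZetaDescentDatumOfContra_of_loc_of_rankOne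
    (hloc : exists_iwasawaH2Data_fineSelmerDual_embedding_loc)
    (W : WeierstrassCurve ℚ) [W.IsElliptic] [W.IsGloballyMinimal] (p : ℕ) [Fact p.Prime] (hp : p ≠ 2)
    (hj : 0 ≤ padicValRat p W.j) (hrk : W.mordellWeilRank = 1) (hsha : Finite (AddCommGroup.primaryComponent W.sha p))
    (hKMC : KatoMainConjectureFineContra W p) :
    ∃ D : KatoDescentDatum p, IsKatoZetaDescentDatumOfContra W p D := by
  letI : ContinuousSMul ℤ_[p] (W.tateModule p) := TateModule.continuousSMul_padicInt
  haveI : Module.Free ℤ_[p] (W.tateModule p) := W.module_free_tateModule_holds p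
  haveI : Module.Finite ℤ_[p] (W.tateModule p) := W.module_finite_tateModule_holds p
  obtain ⟨⟨κ, hκ, γ, hγ, I, z₀, hadm⟩, -⟩ := hKMC Fact.out
  have hz₀ : z₀ ≠ 0 := hadm.ne_zero_of_rohrlich hγ (fun hf ↦ rohrlich_primePow_of_isNewformOf hf)
  -- Thm. 12.4 (2) at this pin from TREE THEOREMS ((12.2.1), torsion-freeness, `z₀ ≠ 0`, (R1)+(R2)) — no `thm12_4`
  have hfin : Module.Finite (IwasawaAlgebra p) I.H := IwasawaH1Data.module_finite_of_isCyclotomic hκ hγ I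
  have htf : Module.IsTorsionFree (IwasawaAlgebra p) I.H := I.isTorsionFree hγ
  haveI := hfin
  haveI := htf
  haveI : Nontrivial I.H := nontrivial_of_ne z₀ 0 hz₀
  have hrk' : Module.rank (IwasawaAlgebra p) I.H = 1 :=
    I.rank_eq_one_of_rank_integralH1_le_one hκ hγ (LocPKummer.rank_integralH1_le_one W p κ hrk hsha)
  let v : HeightOneSpectrum (𝓞 ℚ) := Rat.HeightOneSpectrum.primesEquiv.symm ⟨p, Fact.out⟩
  have hv : ((Rat.HeightOneSpectrum.primesEquiv v : Nat.Primes) : ℕ) = p := by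
    simp only [v, Equiv.apply_symm_apply]
  obtain ⟨J, hJ⟩ := ContraBridge.exists_iwasawaH2Data_lengthAt_eq_forall_fineSelmerDualData_inv hloc.embedding hγ v hp hκ
    hv (finite_fixedPoints_kerSubgroup_inf_decomp W p hj κ hκ v hv) I
  obtain ⟨D, hD, -⟩ :=
    ContraRealizable.exists_isKatoZetaDescentDatumOfContra_of_packages W p hκ hγ I hfin htf hrk' J hJ hz₀ hadm
  exact ⟨D, hD⟩

/-- … the same on a row of ANALYTIC rank `1`, Mordell–Weil rank and finiteness of `Ш` from GZK (`rank_eq_analyticRank_of_analyticRank_le_one`).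
[cite: Kato2004Asterisque, Thm. 12.4 (2) (p. 221), Thm. 12.5 (1) (pp. 221–222), Conj. 12.10 (p. 224), §14.14 (14.14.1) (p. 243)] [cite: GrossZagier1986, Thm. I.7.3] -/
theorem exists_isKatoZetaDescentDatumOfContra_of_loc_of_gzk
    (hGZK : rank_eq_analyticRank_of_analyticRank_le_one)
    (hloc : exists_iwasawaH2Data_fineSelmerDual_embedding_loc)
    (W : WeierstrassCurve ℚ) [W.IsElliptic] [W.IsGloballyMinimal] (p : ℕ) [Fact p.Prime] (hp : p ≠ 2)
    (hj : 0 ≤ padicValRat p W.j) (hr : W.analyticRank = 1) (hKMC : KatoMainConjectureFineContra W p) :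
    ∃ D : KatoDescentDatum p, IsKatoZetaDescentDatumOfContra W p D := by
  obtain ⟨hmw, hsha⟩ := hGZK W (by rw [hr])
  haveI := hsha
  exact exists_isKatoZetaDescentDatumOfContra_of_loc_of_rankOne hloc W p hp hj (by rw [hmw, hr]) inferInstance hKMC

end PerPair

/-! ## §2 Stub 4 on the rows of stmt-BirchSwinnertonDyer-19223 (signed type `(p, I₀*)`, `p ≥ 5`, rank one), GZK-guarded -/

section IstarZero

/-- ★ **STUB 4 ON THE ROWS OF 19223 from H2X′ ALONE, GZK-guarded — no `Kato2004.thm12_4`.**  For every prime `p ≥ 5` and every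
globally minimal `W/ℚ` of signed local type `(p, I₀*)` of analytic rank one: `KatoMainConjectureFineContra W p` realises a Kato descent
datum of the print-exact key.  Binder text = E50's `hCrows` row guards followed by stub 4's per-pair conclusion; row side conditions
as in E48 (`p ≠ 2` from `p ≥ 5`; `0 ≤ v_p j` since CM, `padicValRat_j_nonneg_of_hasCM`).  Intended as the v6 `realizable_closed` of
`kato_perrin_riou_istar` (the planner registers; GZK = `PublishedFactsInert.2.2.1` there).  CONDITIONAL; nothing asserted on 19223.
[cite: Kato2004Asterisque, Thm. 12.4 (2) (p. 221), Thm. 12.5 (1) (pp. 221–222), Conj. 12.10 (p. 224), (14.9.1) (p. 239), §14.14 (14.14.1) (p. 243)]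
[cite: Imai1975, Theorem (p. 12)] [cite: GrossZagier1986, Thm. I.7.3] -/
theorem realizableIstarZeroOfGZK_of_loc (hloc : exists_iwasawaH2Data_fineSelmerDual_embedding_loc) :
    rank_eq_analyticRank_of_analyticRank_le_one →
      ∀ (p : ℕ) [Fact p.Prime], 5 ≤ p → ∀ (W : WeierstrassCurve ℚ) [W.IsElliptic] [W.IsGloballyMinimal],
      HasSignedLocalType W p (.Istar 0) → W.analyticRank = 1 →
      KatoMainConjectureFineContra W p → ∃ D : KatoDescentDatum p, IsKatoZetaDescentDatumOfContra W p D :=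
  fun hGZK p _ hp5 W _ _ hT hr hKMC ↦
    exists_isKatoZetaDescentDatumOfContra_of_loc_of_gzk hGZK hloc W p (by omega) (padicValRat_j_nonneg_of_hasCM W p hT.1) hr hKMC

end IstarZero

/-! ## §3 Stub 4 on the rows of stmt-BirchSwinnertonDyer-19945 (the class 𝒞₇ at `p = 7`), GZK-guarded -/

section ClassCSeven

/-- ★ **STUB 4 ON THE ROWS OF 19945 from H2X′ ALONE, GZK-guarded — no `Kato2004.thm12_4`.**  For every globally minimal `W ∈ 𝒞₇`
(`X12.ClassCSeven W`: CM by `ℚ(√−7)`, analytic rank one, …): `KatoMainConjectureFineContra W 7` realises a Kato descent datum of the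
print-exact key at `7`.  Binder text = E50's `hC7` row guard followed by stub 4's per-pair conclusion (`0 ≤ v₇ j` since CM).  Intended as
the v6 `realizable_closed` of `kato_perrin_riou_zp` (the planner registers; GZK = the crux's own antecedent there).  CONDITIONAL;
nothing asserted on 19945. [cite: Kato2004Asterisque, Thm. 12.4 (2) (p. 221), Thm. 12.5 (1) (pp. 221–222), Conj. 12.10 (p. 224), (14.9.1) (p. 239), §14.14 (14.14.1) (p. 243)]
[cite: Imai1975, Theorem (p. 12)] [cite: GrossZagier1986, Thm. I.7.3] -/
theorem realizableClassCSevenOfGZK_of_loc (hloc : exists_iwasawaH2Data_fineSelmerDual_embedding_loc) :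
    rank_eq_analyticRank_of_analyticRank_le_one →
      ∀ (W : WeierstrassCurve ℚ) [W.IsElliptic] [W.IsGloballyMinimal] [Fact (Nat.Prime 7)],
      X12.ClassCSeven W →
      KatoMainConjectureFineContra W 7 → ∃ D : KatoDescentDatum 7, IsKatoZetaDescentDatumOfContra W 7 D :=
  fun hGZK W _ _ _ h7 hKMC ↦
    exists_isKatoZetaDescentDatumOfContra_of_loc_of_gzk hGZK hloc W 7 (by norm_num) (padicValRat_j_nonneg_of_hasCM W 7 h7.1)
      h7.2.2.1 hKMC

end ClassCSeven

end Summit.BirchSwinnertonDyer.Rank1Residual.Additive.StrictCount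

end
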